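import Literature.MathematicalPhysics.QuantumLattice.XXZGroundStateIsingOrder
import Literature.MathematicalPhysics.QuantumLattice.XYZGroundStateOrderWindow
import Literature.MathematicalPhysics.QuantumLattice.XXZIsingInfraredBound
import HarnessLib

/-!
# Ground-state order of the spin-½ XXZ model on `ℤ²` in the standard (`xxzHamiltonian`) vocabulary: Néel order for `Δ ≥ 5/2`, planar order for `0 ≤ Δ ≤ 0.15`

Topic `MathematicalPhysics/QuantumLattice`. The tree's certified windows for the spin-½ XXZ model on
the square lattice are stated in Björnberg–Ueltschi's rotated ferromagnetic frame
(`anisotropicTorus`, `groundStateAxisCorrTorus`, `HasEvenTorusLRO`):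
`xxz_ground_lro_spinHalf_window` (planar order, `0 ≤ Δ ≤ 0.15`, `XYZGroundStateOrderWindow.lean`)
and `xxz_ground_neel_spinHalf_isingSide` (Ising-axis order, `Δ ≥ 5/2`,
`XXZGroundStateIsingOrder.lean`); their docstrings EXPLAIN the sublattice-rotation dictionary to the
antiferromagnet but do not assert it. This file PROVES the dictionary and restates both windows for
the model as it is written in the physics literature and in the tree's `HeisenbergModel.lean`:

  `xxzHamiltonian n (torusGraph d L) J Δ = J Σ_{⟨x,y⟩} (Sˣ_xSˣ_y + Sʸ_xSʸ_y + Δ Sᶻ_xSᶻ_y)`,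

antiferromagnetic for `J > 0` (Kubo–Kishi / Wischmann–Müller-Hartmann's eq. (1) with `J = 1`), with
the STAGGERED order of `HeisenbergOrder.lean` (`HasStaggeredEvenTorusLRO`, the vocabulary of the
Néel-order facts `kennedy_lieb_shastry_ground`, `dyson_lieb_simon`):

* `xxzAF_ground_neel_spinHalf` — for every `J > 0` and every **`Δ ≥ 5/2`**, the ground states
  (tracial ground-state functional) of the spin-½ XXZ ANTIFERROMAGNET on the even tori `(ℤ/2kℤ)²`
  have staggered (Néel) long-range order of the `z`-component:
  `liminf_k (2k)⁻⁴ Σ_{x,y} (-1)^x(-1)^y ⟨Sᶻ_xSᶻ_y⟩ > 0`;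
* `xxzAF_ground_planar_spinHalf` — for every `J > 0` and **`0 ≤ Δ ≤ 0.15`**, staggered long-range
  order of the `y`- (and, by the `U(1)` symmetry, `x`-) component;
* `hardCoreBoson_ground_planar_spinHalf` — the same planar window for the ferromagnetic-planar sign
  `xxzHamiltonian 1 (torusGraph 2 L) (-1) Δ`, `-0.15 ≤ Δ ≤ 0` (hard-core bosons with nearest-neighbour
  repulsion, the object of the `HubbardSuperconductivity` routes `PlaquetteBoson` /
  `LevyLogBootstrap`): PLAIN planar long-range order `HasEvenTorusLRO`.

Printed statements (S = ½, d = 2, ground state): Kubo–Kishi 1988 (`0 ≤ Δ < 0.13`, `Δ ≥ 1.78`),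
Wischmann–Müller-Hartmann 1991 Abstract p. 647 (`0 ≤ Δ ≤ 0.22`, `Δ ≥ 1.47`); the tree's windows
`[0, 0.15]` and `[5/2, ∞)` are certified (the planar one wider than Kubo–Kishi's, the Ising one
narrower than print — see the TODO in `XXZGroundStateIsingOrder.lean`). The isotropic point
`Δ = 1` (Néel order of the spin-½ Heisenberg antiferromagnet) is OPEN.

## The dictionary (Dyson–Lieb–Simon 1978 §2; Kennedy–Lieb–Shastry 1988; B–U Prop. 2.4)

`xxzHamiltonian n (torusGraph d L) J Δ = H₃(-J,-J,-JΔ)` (`xyzBondHamiltonian₃`, each bond once) and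
`anisotropicTorus d L n a b c = 2H₃(a,b,c)`, so the ground-state functionals of
`xxzHamiltonian … J Δ` and `anisotropicTorus d L n (-J) (-J) (-JΔ)` coincide
(`groundStateFunctional_xxzHamiltonian_torus`). On the even torus the `π`-rotation about the
`y`-axis on the odd sublattice (`sublatticeOpY_conj_anisotropicTorus`) maps `H(a,b,c) ↦ H(-a,b,-c)`,
hence `H(-J,-J,-JΔ) ↦ H(J,-J,JΔ) = JΔ · H(1/Δ,-1/Δ,1)`, and `Sᶻ_x ↦ ε_x Sᶻ_x` with the sublattice sign
`ε_x = (-1)^{Σᵢxᵢ}` (`torusParitySign_eq_neg_one_pow`); the tracial ground state is covariant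
(`Matrix.groundStateFunctional_unitary_conj`) and scale invariant. For the planar component one
rotates instead about the `z`-axis on the odd sublattice (`sublatticeOpZ_conj_anisotropicTorus`:
`H(-J,-J,-JΔ) ↦ H(J,J,-JΔ)`, `Sʸ_x ↦ ε_xSʸ_x`) and then globally by the quarter turn about `x`
(`H(1,1,-Δ) ↦ H(1,-Δ,1)`, `Sʸ ↦ -Sᶻ`), landing on B–U's planar frame.

## References

* [KuboKishi1988] K. Kubo, T. Kishi, Phys. Rev. Lett. 61 (1988) 2585 (model and windows; as reported
  in W–MH 1991 §1).
* [WischmannMullerhartmann1991] H.-A. Wischmann, E. Müller-Hartmann, J. Phys. I France 1 (1991) 647,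
  eq. (1) (the model, `J = 1`, `Δ ≥ 0`), Abstract and §5.
* [DysonLiebSimon1978] F. J. Dyson, E. H. Lieb, B. Simon, J. Stat. Phys. 18 (1978) 335, §2 (sublattice
  rotation of the antiferromagnet).
* [BjornbergUeltschi2022] J. E. Björnberg, D. Ueltschi, arXiv:2204.12896, Prop. 2.4, Thm. 3.2.
* [Tasaki2020] H. Tasaki, *Physics and Mathematics of Quantum Many-Body Systems*, §2.4, §4.1 (the
  XXZ Hamiltonian; `U(1)` symmetry).
-/

noncomputable section

open Matrix Finset Filter Topology
open scoped ComplexOrder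
open Literature.MathematicalPhysics.QuantumLattice Literature.MathematicalPhysics.QuantumLattice.SpinOperators
  Literature.Probability.LatticeModels

namespace Literature.MathematicalPhysics.QuantumLattice

variable {d : ℕ}

/-! ### The object: ground-state correlations of the XXZ model on the torus -/

/-- The ground-state `α–α` correlation `Re ω₀(S^α_x S^α_y)` of the XXZ model
`xxzHamiltonian n (torusGraph d L) J Δ = J Σ_{⟨x,y⟩}(SˣSˣ + SʸSʸ + Δ SᶻSᶻ)` (spin `n/2`) in the
tracial ground-state functional (`β → ∞` before `L → ∞`). **Junk value** `0` at `L = 0`.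
[cite: Tasaki2020, §2.4 and §4.1] [cite: WischmannMullerhartmann1991, eqs. (1), (5)–(7)] -/
def groundStateXXZCorrTorus (α : Fin 3) (L n : ℕ) (J Δ : ℝ) (x y : TorusSite d L) : ℝ :=
  if hL : L = 0 then 0
  else
    haveI : NeZero L := ⟨hL⟩
    ((xxzHamiltonian n (torusGraph d L) J Δ).groundStateFunctional (siteSpin n x α * siteSpin n y α)).re

/-- Junk side of `groundStateXXZCorrTorus` (the definition's `L = 0` branch). [cite: Tasaki2020, §2.4] -/
@[simp] theorem groundStateXXZCorrTorus_zero_side (α : Fin 3) (n : ℕ) (J Δ : ℝ) (x y : TorusSite d 0) :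
    groundStateXXZCorrTorus α 0 n J Δ x y = 0 := by
  simp [groundStateXXZCorrTorus]

/-- Unfolding `groundStateXXZCorrTorus` on a genuine torus. [cite: Tasaki2020, §2.4 and §4.1] -/
theorem groundStateXXZCorrTorus_of_neZero (α : Fin 3) (L : ℕ) [NeZero L] (n : ℕ) (J Δ : ℝ)
    (x y : TorusSite d L) :
    groundStateXXZCorrTorus α L n J Δ x y =
      ((xxzHamiltonian n (torusGraph d L) J Δ).groundStateFunctional
        (siteSpin n x α * siteSpin n y α)).re := by
  simp [groundStateXXZCorrTorus, NeZero.ne L]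

/-! ### `xxzHamiltonian` on the torus is B–U's bond Hamiltonian `H₃(-J,-J,-JΔ)` -/

section Model

variable (L : ℕ) [NeZero L] (n : ℕ)

/-- `J Σ_e (b⁰ + b¹ + Δ b²) = -Σ_e ((-J)b⁰ + (-J)b¹ + (-JΔ)b²)`: the XXZ Hamiltonian on the torus is the
three-coupling bond Hamiltonian `xyzBondHamiltonian₃ L n (-J) (-J) (-(J Δ))`.
[cite: BjornbergUeltschi2022, eq. (2.4)] [cite: Tasaki2020, §2.4] -/
theorem xxzHamiltonian_torus_eq_three (J Δ : ℝ) :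
    xxzHamiltonian n (torusGraph d L) J Δ = xyzBondHamiltonian₃ L n (-J) (-J) (-(J * Δ)) := by
  rw [xxzHamiltonian, xyzBondHamiltonian₃, Finset.smul_sum, ← Finset.sum_neg_distrib]
  refine sum_congr rfl fun e _ => ?_
  induction e using Sym2.ind with
  | h x y =>
    simp only [Sym2.lift_mk, xyzBond₃, smul_add, smul_smul, Complex.ofReal_neg, Complex.ofReal_mul,
      neg_smul, neg_add_rev, neg_neg]
    abel

/-- **Same ground states**: the tracial ground-state functional of `xxzHamiltonian n (torusGraph d L) J Δ`
is that of B–U's `anisotropicTorus d L n (-J) (-J) (-(JΔ))` (`= 2H₃(-J,-J,-JΔ)`).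
[cite: BjornbergUeltschi2022, §2 (p. 4)] -/
theorem groundStateFunctional_xxzHamiltonian_torus (J Δ : ℝ) :
    (xxzHamiltonian n (torusGraph d L) J Δ).groundStateFunctional =
      (anisotropicTorus d L n (-J) (-J) (-(J * Δ))).groundStateFunctional := by
  rw [xxzHamiltonian_torus_eq_three, groundStateFunctional_anisotropicTorus_three]

end Model

/-! ### The sublattice sign and the half-turn about the `y`-axis -/

section Sublattice

/-- **The parity sign of the even torus is `(-1)^{Σᵢ xᵢ}`** on canonical representatives: the sign
used by the sublattice rotations (`torusParity_sign_adj`, parity through `ZMod.castHom`) equals the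
Néel sign of `hasStaggeredEvenTorusLRO_iff`. [cite: DysonLiebSimon1978, §1–§2] -/
theorem torusParitySign_eq_neg_one_pow (k : ℕ) [NeZero (2 * k)] (z : TorusSite d (2 * k)) :
    (if (∑ j, ZMod.castHom (dvd_mul_right 2 k) (ZMod 2) (z j)) = 0 then (1 : ℂ) else -1) =
      (((-1 : ℝ) ^ (∑ i, (z i).val) : ℝ) : ℂ) := by
  have hcast : (∑ j, ZMod.castHom (dvd_mul_right 2 k) (ZMod 2) (z j)) =
      (((∑ i, (z i).val : ℕ)) : ZMod 2) := by
    rw [Nat.cast_sum]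
    refine sum_congr rfl fun j _ => ?_
    rw [ZMod.castHom_apply, ZMod.cast_eq_val]
  rw [hcast]
  by_cases h : Even (∑ i, (z i).val)
  · rw [if_pos (ZMod.natCast_eq_zero_iff_even.2 h), h.neg_one_pow]
    push_cast
    rfl
  · rw [if_neg (fun h' => h (ZMod.natCast_eq_zero_iff_even.1 h')), (Nat.not_even_iff_odd.1 h).neg_one_pow]
    push_cast
    rfl

variable (n : ℕ)

/-- The rotation by `π` about the `2`-axis (`y`): a unitary `T` with `T Sˣ Tᴴ = -Sˣ`, `T Sʸ Tᴴ = Sʸ`,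
`T Sᶻ Tᴴ = -Sᶻ` (the square of the quarter turn `exists_unitary_conj_spinZ_eq_spinX`).
[cite: BjornbergUeltschi2022, Prop. 2.4] -/
theorem exists_halfTurn_y :
    ∃ T : Matrix (Fin (n + 1)) (Fin (n + 1)) ℂ, T * Tᴴ = 1 ∧ Tᴴ * T = 1 ∧
      T * spinX n * Tᴴ = -spinX n ∧ T * spinY n * Tᴴ = spinY n ∧
      T * SpinOperators.spinZ n * Tᴴ = -SpinOperators.spinZ n := by
  obtain ⟨V, hV, hV', hVz, hVx, hVy⟩ := exists_unitary_conj_spinZ_eq_spinX n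
  have conj2 : ∀ A : Matrix (Fin (n + 1)) (Fin (n + 1)) ℂ,
      V * V * A * (V * V)ᴴ = V * (V * A * Vᴴ) * Vᴴ := by
    intro A
    rw [conjTranspose_mul]
    simp only [Matrix.mul_assoc]
  refine ⟨V * V, ?_, ?_, ?_, ?_, ?_⟩
  · rw [conjTranspose_mul, Matrix.mul_assoc, ← Matrix.mul_assoc V Vᴴ, hV, Matrix.one_mul, hV]
  · rw [conjTranspose_mul, Matrix.mul_assoc, ← Matrix.mul_assoc Vᴴ V, hV', Matrix.one_mul, hV']
  · rw [conj2, hVx, Matrix.mul_neg, Matrix.neg_mul, hVz]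
  · rw [conj2, hVy, hVy]
  · rw [conj2, hVz, hVx]

variable {n}

/-- **Sublattice half-turn about the second axis flips the first and third couplings**
(Dyson–Lieb–Simon 1978 §2 — THE rotation that maps the antiferromagnet to a ferromagnet in `x` and
`z`; B–U Prop. 2.4): on the even torus, for a single-site unitary `t` with `t Sˣ tᴴ = -Sˣ`,
`t Sʸ tᴴ = Sʸ`, `t Sᶻ tᴴ = -Sᶻ` placed on the odd sublattice, `U H(a,b,c) Uᴴ = H(-a,b,-c)`.
[cite: DysonLiebSimon1978, §2] [cite: BjornbergUeltschi2022, Prop. 2.4] -/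
theorem sublatticeOpY_conj_anisotropicTorus (k : ℕ) [NeZero (2 * k)]
    {t : Matrix (Fin (n + 1)) (Fin (n + 1)) ℂ} (hta : t * tᴴ = 1) (htb : tᴴ * t = 1)
    (htx : t * spinX n * tᴴ = -spinX n) (hty : t * spinY n * tᴴ = spinY n)
    (htz : t * SpinOperators.spinZ n * tᴴ = -SpinOperators.spinZ n) (a b c : ℝ) :
    productOp (fun z : TorusSite d (2 * k) =>
        if (∑ j, ZMod.castHom (dvd_mul_right 2 k) (ZMod 2) (z j)) = 0 then (1 : Matrix _ _ ℂ) else t) *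
        anisotropicTorus d (2 * k) n a b c *
        (productOp (fun z : TorusSite d (2 * k) =>
          if (∑ j, ZMod.castHom (dvd_mul_right 2 k) (ZMod 2) (z j)) = 0 then (1 : Matrix _ _ ℂ) else t))ᴴ =
      anisotropicTorus d (2 * k) n (-a) b (-c) := by
  set u : TorusSite d (2 * k) → Matrix (Fin (n + 1)) (Fin (n + 1)) ℂ := fun z =>
    if (∑ j, ZMod.castHom (dvd_mul_right 2 k) (ZMod 2) (z j)) = 0 then 1 else t with hu
  set sgn : TorusSite d (2 * k) → ℂ := fun z =>
    if (∑ j, ZMod.castHom (dvd_mul_right 2 k) (ZMod 2) (z j)) = 0 then 1 else -1 with hsgn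
  have hua : ∀ z, u z * (u z)ᴴ = 1 := by
    intro z; simp only [hu]; split_ifs
    · rw [conjTranspose_one, Matrix.mul_one]
    · exact hta
  have hub : ∀ z, (u z)ᴴ * u z = 1 := by
    intro z; simp only [hu]; split_ifs
    · rw [conjTranspose_one, Matrix.mul_one]
    · exact htb
  have hux : ∀ z, u z * spinVec n 0 * (u z)ᴴ = sgn z • spinVec n 0 := by
    intro z; simp only [hu, hsgn, spinVec_zero]; split_ifs
    · rw [conjTranspose_one, Matrix.mul_one, Matrix.one_mul, one_smul]
    · rw [htx, neg_one_smul]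
  have huy : ∀ z, u z * spinVec n 1 * (u z)ᴴ = spinVec n 1 := by
    intro z; simp only [hu, spinVec_one]; split_ifs
    · rw [conjTranspose_one, Matrix.mul_one, Matrix.one_mul]
    · exact hty
  have huz : ∀ z, u z * spinVec n 2 * (u z)ᴴ = sgn z • spinVec n 2 := by
    intro z; simp only [hu, hsgn, spinVec_two]; split_ifs
    · rw [conjTranspose_one, Matrix.mul_one, Matrix.one_mul, one_smul]
    · rw [htz, neg_one_smul]
  rw [productOp_conj_anisotropicTorus (2 * k) n hua hub, anisotropicTorus_eq]
  rw [neg_inj]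
  refine sum_congr rfl fun x _ => sum_congr rfl fun y _ => ?_
  split_ifs with h
  · have hs : sgn x * sgn y = -1 := torusParity_sign_adj k h
    rw [hux, hux, huy, huy, huz, huz, onSite_smul', onSite_smul', onSite_smul', onSite_smul',
      smul_mul_smul_comm, smul_mul_smul_comm, hs]
    simp only [neg_smul, one_smul, smul_neg, Complex.ofReal_neg]
    rfl
  · rfl

/-- **The sublattice rotation on the probed observable**: with `u` as in the sublattice lemmas and
`u_z S^α u_zᴴ = ε_z S^α` (`ε` the parity sign), `U (S^α_x S^α_y) Uᴴ = (ε_x ε_y) • S^α_x S^α_y`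
(Dyson–Lieb–Simon's sublattice rotation acting on the two-point observable). [cite: DysonLiebSimon1978, §2] -/
theorem sublatticeOp_conj_siteSpin_mul (k : ℕ) [NeZero (2 * k)]
    {t : Matrix (Fin (n + 1)) (Fin (n + 1)) ℂ} (hta : t * tᴴ = 1) (htb : tᴴ * t = 1) (α : Fin 3)
    (ht : t * spinVec n α * tᴴ = -spinVec n α) (x y : TorusSite d (2 * k)) :
    productOp (fun z : TorusSite d (2 * k) =>
        if (∑ j, ZMod.castHom (dvd_mul_right 2 k) (ZMod 2) (z j)) = 0 then (1 : Matrix _ _ ℂ) else t) *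
        (siteSpin n x α * siteSpin n y α) *
        (productOp (fun z : TorusSite d (2 * k) =>
          if (∑ j, ZMod.castHom (dvd_mul_right 2 k) (ZMod 2) (z j)) = 0 then (1 : Matrix _ _ ℂ) else t))ᴴ =
      ((if (∑ j, ZMod.castHom (dvd_mul_right 2 k) (ZMod 2) (x j)) = 0 then (1 : ℂ) else -1) *
        (if (∑ j, ZMod.castHom (dvd_mul_right 2 k) (ZMod 2) (y j)) = 0 then (1 : ℂ) else -1)) •
        (siteSpin n x α * siteSpin n y α) := by
  set u : TorusSite d (2 * k) → Matrix (Fin (n + 1)) (Fin (n + 1)) ℂ := fun z =>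
    if (∑ j, ZMod.castHom (dvd_mul_right 2 k) (ZMod 2) (z j)) = 0 then 1 else t with hu
  set sgn : TorusSite d (2 * k) → ℂ := fun z =>
    if (∑ j, ZMod.castHom (dvd_mul_right 2 k) (ZMod 2) (z j)) = 0 then 1 else -1 with hsgn
  have hua : ∀ z, u z * (u z)ᴴ = 1 := by
    intro z; simp only [hu]; split_ifs
    · rw [conjTranspose_one, Matrix.mul_one]
    · exact hta
  have hub : ∀ z, (u z)ᴴ * u z = 1 := by
    intro z; simp only [hu]; split_ifs
    · rw [conjTranspose_one, Matrix.mul_one]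
    · exact htb
  have huα : ∀ z, u z * spinVec n α * (u z)ᴴ = sgn z • spinVec n α := by
    intro z; simp only [hu, hsgn]; split_ifs
    · rw [conjTranspose_one, Matrix.mul_one, Matrix.one_mul, one_smul]
    · rw [ht, neg_one_smul]
  show productOp u * (siteSpin n x α * siteSpin n y α) * (productOp u)ᴴ =
    (sgn x * sgn y) • (siteSpin n x α * siteSpin n y α)
  rw [productOp_conj_mul hub, productOp_conj_siteSpin hua, productOp_conj_siteSpin hua, huα, huα,
    onSite_smul', onSite_smul', smul_mul_smul_comm]
  rfl

end Sublattice

/-! ### The Ising-axis dictionary and Néel order of the antiferromagnet for `Δ ≥ 5/2` -/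

section IsingAxis

/-- **The `z`-component of the antiferromagnet is the staggered third component of B–U's frame.**
On the even torus `(ℤ/2kℤ)^d`, for `J > 0`, `Δ > 0`, every spin and all sites:
`Re ω_{XXZ(J,Δ)}(Sᶻ_xSᶻ_y) = (-1)^x(-1)^y · Re ω_{H(1/Δ,-1/Δ,1)}(Sᶻ_xSᶻ_y)`, i.e.
`groundStateXXZCorrTorus 2 (2k) n J Δ x y = (-1)^{Σxᵢ}(-1)^{Σyᵢ} · groundStateAxisCorrTorus (2k) n (1/Δ) (-(1/Δ)) 1 x y`
(sublattice half-turn about `y`: `XXZ(J,Δ) = H₃(-J,-J,-JΔ) ↦ ½H(J,-J,JΔ) = (JΔ/2)·H(1/Δ,-1/Δ,1)`).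
[cite: DysonLiebSimon1978, §2] [cite: BjornbergUeltschi2022, Prop. 2.4] -/
theorem groundStateXXZCorrTorus_two_eq_stagger_mul (k : ℕ) [NeZero (2 * k)] (n : ℕ) {J Δ : ℝ}
    (hJ : 0 < J) (hΔ : 0 < Δ) (x y : TorusSite d (2 * k)) :
    groundStateXXZCorrTorus 2 (2 * k) n J Δ x y =
      (-1 : ℝ) ^ (∑ i, (x i).val) * (-1) ^ (∑ i, (y i).val) *
        groundStateAxisCorrTorus (2 * k) n (1 / Δ) (-(1 / Δ)) 1 x y := by
  obtain ⟨T, hT, hT', hTx, hTy, hTz⟩ := exists_halfTurn_y n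
  set U : Op (TorusSite d (2 * k)) (n + 1) := productOp (fun z : TorusSite d (2 * k) =>
    if (∑ j, ZMod.castHom (dvd_mul_right 2 k) (ZMod 2) (z j)) = 0 then (1 : Matrix _ _ ℂ) else T) with hU
  have hua : ∀ z : TorusSite d (2 * k), (fun z : TorusSite d (2 * k) =>
      if (∑ j, ZMod.castHom (dvd_mul_right 2 k) (ZMod 2) (z j)) = 0 then (1 : Matrix _ _ ℂ) else T) z *
      ((fun z : TorusSite d (2 * k) =>
      if (∑ j, ZMod.castHom (dvd_mul_right 2 k) (ZMod 2) (z j)) = 0 then (1 : Matrix _ _ ℂ) else T) z)ᴴ = 1 := by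
    intro z; dsimp only; split_ifs
    · rw [conjTranspose_one, Matrix.mul_one]
    · exact hT
  have hub : ∀ z : TorusSite d (2 * k), ((fun z : TorusSite d (2 * k) =>
      if (∑ j, ZMod.castHom (dvd_mul_right 2 k) (ZMod 2) (z j)) = 0 then (1 : Matrix _ _ ℂ) else T) z)ᴴ *
      (fun z : TorusSite d (2 * k) =>
      if (∑ j, ZMod.castHom (dvd_mul_right 2 k) (ZMod 2) (z j)) = 0 then (1 : Matrix _ _ ℂ) else T) z = 1 := by
    intro z; dsimp only; split_ifs
    · rw [conjTranspose_one, Matrix.mul_one]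
    · exact hT'
  have hUU : U * Uᴴ = 1 := productOp_mul_conjTranspose hua
  have hUU' : Uᴴ * U = 1 := productOp_conjTranspose_mul hub
  -- the Hamiltonian in the rotated frame
  have hH : U * anisotropicTorus d (2 * k) n (-J) (-J) (-(J * Δ)) * Uᴴ =
      (((J * Δ : ℝ)) : ℂ) • anisotropicTorus d (2 * k) n (1 / Δ) (-(1 / Δ)) 1 := by
    rw [hU, sublatticeOpY_conj_anisotropicTorus k hT hT' hTx hTy hTz, neg_neg, neg_neg,
      ← anisotropicTorus_mul_left]
    congr 1
    · field_simp
    · field_simp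
    · ring
  -- the observable in the rotated frame
  have hO := sublatticeOp_conj_siteSpin_mul (d := d) k hT hT' 2 (by simpa [spinVec_two] using hTz) x y
  rw [torusParitySign_eq_neg_one_pow, torusParitySign_eq_neg_one_pow, ← Complex.ofReal_mul, ← hU] at hO
  -- assemble
  rw [groundStateXXZCorrTorus_of_neZero, groundStateAxisCorrTorus_of_neZero,
    groundStateFunctional_xxzHamiltonian_torus,
    ← Matrix.groundStateFunctional_unitary_conj hUU hUU' (siteSpin n x 2 * siteSpin n y 2), hH, hO,
    groundStateFunctional_smul_of_pos (anisotropicTorus_isHermitian (2 * k) n _ _ _) (by positivity),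
    LinearMap.map_smul_of_tower, smul_eq_mul, Complex.re_ofReal_mul]

/-- **Staggered order of `G` is plain order of `G'` when `G = ε ε G'` on the even tori**
(`ε = (-1)^{Σxᵢ}` on canonical representatives): a bookkeeping lemma between
`HasStaggeredEvenTorusLRO` (`HeisenbergOrder.lean`) and `HasEvenTorusLRO` (`XYOrder.lean`).
[cite: DysonLiebSimon1978, §1] -/
theorem hasStaggeredEvenTorusLRO_iff_hasEvenTorusLRO_of_eq
    {G G' : (L : ℕ) → TorusSite d L → TorusSite d L → ℝ}
    (h : ∀ (k : ℕ) (x y : Site d), x ∈ halfOpenBox d (2 * k) → y ∈ halfOpenBox d (2 * k) →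
      latticeStagger x * latticeStagger y * torusPullback G (2 * k) x y = torusPullback G' (2 * k) x y) :
    HasStaggeredEvenTorusLRO G ↔ HasEvenTorusLRO G' := by
  unfold HasStaggeredEvenTorusLRO HasStaggeredLongRangeOrder HasEvenTorusLRO HasLongRangeOrder
  have hfun : (fun k : ℕ => (∑ x ∈ halfOpenBox d (2 * k), ∑ y ∈ halfOpenBox d (2 * k),
      latticeStagger x * latticeStagger y * torusPullback G (2 * k) x y) /
        ((halfOpenBox d (2 * k)).card : ℝ) ^ 2) =
      (fun k : ℕ => (∑ x ∈ halfOpenBox d (2 * k), ∑ y ∈ halfOpenBox d (2 * k),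
        torusPullback G' (2 * k) x y) / ((halfOpenBox d (2 * k)).card : ℝ) ^ 2) := by
    funext k
    congr 1
    exact sum_congr rfl fun x hx => sum_congr rfl fun y hy => h k x y hx hy
  rw [hfun]

/-- **The antiferromagnet's `z`-order is B–U's third-component order** (`d = 2`, spin `n/2`, `J > 0`,
`Δ > 0`): `HasStaggeredEvenTorusLRO` of `groundStateXXZCorrTorus 2 · n J Δ` is `HasEvenTorusLRO` of
`groundStateAxisCorrTorus · n (1/Δ) (-(1/Δ)) 1`. [cite: DysonLiebSimon1978, §1–§2]
[cite: BjornbergUeltschi2022, Prop. 2.4] -/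
theorem hasStaggeredEvenTorusLRO_xxz_two_iff (n : ℕ) {J Δ : ℝ} (hJ : 0 < J) (hΔ : 0 < Δ) :
    HasStaggeredEvenTorusLRO (fun L x y => groundStateXXZCorrTorus 2 (d := 2) L n J Δ x y) ↔
      HasEvenTorusLRO (fun L x y => groundStateAxisCorrTorus (d := 2) L n (1 / Δ) (-(1 / Δ)) 1 x y) := by
  refine hasStaggeredEvenTorusLRO_iff_hasEvenTorusLRO_of_eq fun k x y hx hy => ?_
  rcases Nat.eq_zero_or_pos k with rfl | hk
  · exfalso
    have := (mem_halfOpenBox.1 hx) 0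
    omega
  · haveI : NeZero (2 * k) := ⟨by omega⟩
    rw [torusPullback_apply, torusPullback_apply, latticeStagger_eq_of_mem_halfOpenBox hx,
      latticeStagger_eq_of_mem_halfOpenBox hy,
      groundStateXXZCorrTorus_two_eq_stagger_mul k n hJ hΔ]
    have h1 : ((-1 : ℝ) ^ (∑ i, (Torus.proj (2 * k) x i).val)) ^ 2 = 1 := by
      rw [← pow_mul, mul_comm, pow_mul, neg_one_sq, one_pow]
    have h2 : ((-1 : ℝ) ^ (∑ i, (Torus.proj (2 * k) y i).val)) ^ 2 = 1 := by
      rw [← pow_mul, mul_comm, pow_mul, neg_one_sq, one_pow]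
    linear_combination (groundStateAxisCorrTorus (2 * k) n (1 / Δ) (-(1 / Δ)) 1 (Torus.proj (2 * k) x)
      (Torus.proj (2 * k) y)) * (h1 * ((-1 : ℝ) ^ (∑ i, (Torus.proj (2 * k) y i).val)) ^ 2 + h2)

/-- **Néel order of the spin-½ XXZ antiferromagnet on `ℤ²` for `Δ ≥ 5/2`.** For every `J > 0` and
every `Δ ≥ 5/2`, the ground states (tracial ground-state functional, `β → ∞` before `L → ∞`) of
`xxzHamiltonian 1 (torusGraph 2 L) J Δ = J Σ_{⟨x,y⟩}(SˣSˣ + SʸSʸ + ΔSᶻSᶻ)` on the even tori `(ℤ/2kℤ)²`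
have STAGGERED long-range order of the `z`-component:
`liminf_k (2k)⁻⁴ Σ_{x,y} (-1)^x (-1)^y ⟨Sᶻ_x Sᶻ_y⟩_GS > 0` — the same vocabulary as the open
`Δ = 1` statement (Néel order of the spin-½ Heisenberg antiferromagnet, the excluded case of
`kennedy_lieb_shastry_ground`). A certified sub-window of the printed Ising-like region
(`Δ ≥ 1.78` Kubo–Kishi 1988, `Δ ≥ 1.47` W–MH 1991); the dictionary applied to
`xxz_ground_neel_spinHalf_isingSide'`. [cite: WischmannMullerhartmann1991, Abstract (p. 647) and §1 (p. 648)]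
[cite: KuboKishi1988] -/
theorem xxzAF_ground_neel_spinHalf (J : ℝ) (hJ : 0 < J) (Δ : ℝ) (hΔ : 5 / 2 ≤ Δ) :
    HasStaggeredEvenTorusLRO (fun L x y => groundStateXXZCorrTorus 2 (d := 2) L 1 J Δ x y) := by
  rw [hasStaggeredEvenTorusLRO_xxz_two_iff 1 hJ (by linarith)]
  exact xxz_ground_neel_spinHalf_isingSide' Δ hΔ

end IsingAxis

/-! ### Global frame changes on two-point functions -/

section Global

variable (L : ℕ) [NeZero L] (n : ℕ)

/-- **The quarter turn about `x` on two-point functions**: `ω_{H(a,b,c)}(Sʸ_xSʸ_y) = ω_{H(a,c,b)}(Sᶻ_xSᶻ_y)`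
(global rotation `Sʸ ↦ -Sᶻ`, `Sᶻ ↦ Sʸ`, `H(a,b,c) ↦ H(a,c,b)`; B–U Prop. 2.4 for the transposition of
the last two axes). [cite: BjornbergUeltschi2022, Prop. 2.4] -/
theorem groundStateFunctional_anisotropicTorus_quarterTurnX (a b c : ℝ) (x y : TorusSite d L) :
    (anisotropicTorus d L n a b c).groundStateFunctional (siteSpin n x 1 * siteSpin n y 1) =
      (anisotropicTorus d L n a c b).groundStateFunctional (siteSpin n x 2 * siteSpin n y 2) := by
  obtain ⟨R, hR, hR', hRx, hRy, hRz⟩ := exists_quarterTurn_x n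
  set W : Op (TorusSite d L) (n + 1) := productOp (fun _ : TorusSite d L => R) with hW
  have hWW : W * Wᴴ = 1 := productOp_mul_conjTranspose fun _ => hR
  have hWW' : Wᴴ * W = 1 := productOp_conjTranspose_mul fun _ => hR'
  have hH : W * anisotropicTorus d L n a b c * Wᴴ = anisotropicTorus d L n a c b := by
    rw [hW, globalOp_conj_anisotropicTorus hR hR' (γ := ![0, 2, 1]) (ε := ![1, -1, 1])
      (fun α => by fin_cases α <;> simp) (fun α => by
        fin_cases α
        · simpa using hRx
        · simpa using hRy
        · simpa using hRz) a b c, anisotropicTorus_eq]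
    rw [neg_inj]
    refine sum_congr rfl fun x _ => sum_congr rfl fun y _ => ?_
    split_ifs
    · simp only [Matrix.cons_val_zero, Matrix.cons_val_one, Matrix.cons_val]
      abel
    · rfl
  have hO : W * (siteSpin n x 1 * siteSpin n y 1) * Wᴴ = siteSpin n x 2 * siteSpin n y 2 := by
    rw [hW, productOp_conj_mul (fun _ => hR'), productOp_conj_siteSpin (fun _ => hR),
      productOp_conj_siteSpin (fun _ => hR), spinVec_one, hRy, onSite_neg', onSite_neg', neg_mul_neg]
    rfl
  rw [← Matrix.groundStateFunctional_unitary_conj hWW hWW' (siteSpin n x 1 * siteSpin n y 1), hH, hO]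

/-- **The `U(1)` symmetry on two-point functions**: for equal planar couplings,
`ω_{H(a,a,c)}(Sˣ_xSˣ_y) = ω_{H(a,a,c)}(Sʸ_xSʸ_y)` (global quarter turn about `z`: `Sˣ ↦ -Sʸ`, `Sʸ ↦ Sˣ`,
which fixes `H(a,a,c)`). [cite: Tasaki2020, §2.4 (U(1) symmetry of the XXZ model)]
[cite: BjornbergUeltschi2022, Prop. 2.4] -/
theorem groundStateFunctional_anisotropicTorus_planar_symm (a c : ℝ) (x y : TorusSite d L) :
    (anisotropicTorus d L n a a c).groundStateFunctional (siteSpin n x 0 * siteSpin n y 0) =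
      (anisotropicTorus d L n a a c).groundStateFunctional (siteSpin n x 1 * siteSpin n y 1) := by
  obtain ⟨D, hD, hD', hDx, hDy, hDz⟩ := exists_unitary_conj_spinX_eq_neg_spinY n
  set W : Op (TorusSite d L) (n + 1) := productOp (fun _ : TorusSite d L => D) with hW
  have hWW : W * Wᴴ = 1 := productOp_mul_conjTranspose fun _ => hD
  have hWW' : Wᴴ * W = 1 := productOp_conjTranspose_mul fun _ => hD'
  have hH : W * anisotropicTorus d L n a a c * Wᴴ = anisotropicTorus d L n a a c := by
    rw [hW, globalOp_conj_anisotropicTorus hD hD' (γ := ![1, 0, 2]) (ε := ![-1, 1, 1])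
      (fun α => by fin_cases α <;> simp) (fun α => by
        fin_cases α
        · simpa using hDx
        · simpa using hDy
        · simpa using hDz) a a c, anisotropicTorus_eq]
    rw [neg_inj]
    refine sum_congr rfl fun x _ => sum_congr rfl fun y _ => ?_
    split_ifs
    · simp only [Matrix.cons_val_zero, Matrix.cons_val_one, Matrix.cons_val]
      abel
    · rfl
  have hO : W * (siteSpin n x 0 * siteSpin n y 0) * Wᴴ = siteSpin n x 1 * siteSpin n y 1 := by
    rw [hW, productOp_conj_mul (fun _ => hD'), productOp_conj_siteSpin (fun _ => hD),
      productOp_conj_siteSpin (fun _ => hD), spinVec_zero, hDx, onSite_neg', onSite_neg', neg_mul_neg]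
    rfl
  rw [← Matrix.groundStateFunctional_unitary_conj hWW hWW' (siteSpin n x 0 * siteSpin n y 0), hH, hO]

/-- **`U(1)` symmetry of the XXZ ground-state correlations**: the `x–x` and `y–y` correlations agree,
`groundStateXXZCorrTorus 0 = groundStateXXZCorrTorus 1` (any side, spin, `J`, `Δ`).
[cite: Tasaki2020, §2.4 and §4.1] -/
theorem groundStateXXZCorrTorus_zero_eq_one (L n : ℕ) (J Δ : ℝ) (x y : TorusSite d L) :
    groundStateXXZCorrTorus 0 L n J Δ x y = groundStateXXZCorrTorus 1 L n J Δ x y := by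
  rcases Nat.eq_zero_or_pos L with rfl | hL
  · simp
  · haveI : NeZero L := ⟨hL.ne'⟩
    rw [groundStateXXZCorrTorus_of_neZero, groundStateXXZCorrTorus_of_neZero,
      groundStateFunctional_xxzHamiltonian_torus, groundStateFunctional_anisotropicTorus_planar_symm]

end Global

/-! ### The planar dictionary; planar order of the antiferromagnet for `0 ≤ Δ ≤ 0.15` -/

section Planar

/-- **The `y`-component of the antiferromagnet is the staggered third component of B–U's planar frame.**
On the even torus `(ℤ/2kℤ)^d`, for `J > 0`, every `Δ`, every spin and all sites:
`groundStateXXZCorrTorus 1 (2k) n J Δ x y = (-1)^{Σxᵢ}(-1)^{Σyᵢ} · groundStateAxisCorrTorus (2k) n 1 (-Δ) 1 x y`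
(sublattice half-turn about `z`: `H₃(-J,-J,-JΔ) ↦ ½H(J,J,-JΔ) = (J/2)·H(1,1,-Δ)`, `Sʸ_z ↦ ε_zSʸ_z`; then
the global quarter turn about `x`: `H(1,1,-Δ) ↦ H(1,-Δ,1)`, `SʸSʸ ↦ SᶻSᶻ`).
[cite: DysonLiebSimon1978, §2] [cite: BjornbergUeltschi2022, Prop. 2.4] -/
theorem groundStateXXZCorrTorus_one_eq_stagger_mul (k : ℕ) [NeZero (2 * k)] (n : ℕ) {J : ℝ}
    (hJ : 0 < J) (Δ : ℝ) (x y : TorusSite d (2 * k)) :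
    groundStateXXZCorrTorus 1 (2 * k) n J Δ x y =
      (-1 : ℝ) ^ (∑ i, (x i).val) * (-1) ^ (∑ i, (y i).val) *
        groundStateAxisCorrTorus (2 * k) n 1 (-Δ) 1 x y := by
  obtain ⟨T, hT, hT', hTx, hTy, hTz⟩ := exists_halfTurn_z n
  set U : Op (TorusSite d (2 * k)) (n + 1) := productOp (fun z : TorusSite d (2 * k) =>
    if (∑ j, ZMod.castHom (dvd_mul_right 2 k) (ZMod 2) (z j)) = 0 then (1 : Matrix _ _ ℂ) else T) with hU
  have hua : ∀ z : TorusSite d (2 * k), (fun z : TorusSite d (2 * k) =>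
      if (∑ j, ZMod.castHom (dvd_mul_right 2 k) (ZMod 2) (z j)) = 0 then (1 : Matrix _ _ ℂ) else T) z *
      ((fun z : TorusSite d (2 * k) =>
      if (∑ j, ZMod.castHom (dvd_mul_right 2 k) (ZMod 2) (z j)) = 0 then (1 : Matrix _ _ ℂ) else T) z)ᴴ = 1 := by
    intro z; dsimp only; split_ifs
    · rw [conjTranspose_one, Matrix.mul_one]
    · exact hT
  have hub : ∀ z : TorusSite d (2 * k), ((fun z : TorusSite d (2 * k) =>
      if (∑ j, ZMod.castHom (dvd_mul_right 2 k) (ZMod 2) (z j)) = 0 then (1 : Matrix _ _ ℂ) else T) z)ᴴ *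
      (fun z : TorusSite d (2 * k) =>
      if (∑ j, ZMod.castHom (dvd_mul_right 2 k) (ZMod 2) (z j)) = 0 then (1 : Matrix _ _ ℂ) else T) z = 1 := by
    intro z; dsimp only; split_ifs
    · rw [conjTranspose_one, Matrix.mul_one]
    · exact hT'
  have hUU : U * Uᴴ = 1 := productOp_mul_conjTranspose hua
  have hUU' : Uᴴ * U = 1 := productOp_conjTranspose_mul hub
  -- the Hamiltonian in the rotated frame
  have hH : U * anisotropicTorus d (2 * k) n (-J) (-J) (-(J * Δ)) * Uᴴ =
      ((J : ℝ) : ℂ) • anisotropicTorus d (2 * k) n 1 1 (-Δ) := by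
    rw [hU, sublatticeOpZ_conj_anisotropicTorus k hT hT' hTx hTy hTz, neg_neg, ← anisotropicTorus_mul_left]
    congr 1
    · ring
    · ring
    · ring
  -- the observable in the rotated frame
  have hO := sublatticeOp_conj_siteSpin_mul (d := d) k hT hT' 1 (by simpa [spinVec_one] using hTy) x y
  rw [torusParitySign_eq_neg_one_pow, torusParitySign_eq_neg_one_pow, ← Complex.ofReal_mul, ← hU] at hO
  -- assemble
  rw [groundStateXXZCorrTorus_of_neZero, groundStateAxisCorrTorus_of_neZero,
    groundStateFunctional_xxzHamiltonian_torus,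
    ← Matrix.groundStateFunctional_unitary_conj hUU hUU' (siteSpin n x 1 * siteSpin n y 1), hH, hO,
    groundStateFunctional_smul_of_pos (anisotropicTorus_isHermitian (2 * k) n _ _ _) hJ,
    LinearMap.map_smul_of_tower, smul_eq_mul, Complex.re_ofReal_mul,
    groundStateFunctional_anisotropicTorus_quarterTurnX]

/-- **The antiferromagnet's planar order is B–U's planar-frame order** (`d = 2`, spin `n/2`, `J > 0`, any
`Δ`): `HasStaggeredEvenTorusLRO` of `groundStateXXZCorrTorus 1 · n J Δ` is `HasEvenTorusLRO` of
`groundStateAxisCorrTorus · n 1 (-Δ) 1`. [cite: DysonLiebSimon1978, §1–§2] [cite: BjornbergUeltschi2022, Prop. 2.4] -/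
theorem hasStaggeredEvenTorusLRO_xxz_one_iff (n : ℕ) {J : ℝ} (hJ : 0 < J) (Δ : ℝ) :
    HasStaggeredEvenTorusLRO (fun L x y => groundStateXXZCorrTorus 1 (d := 2) L n J Δ x y) ↔
      HasEvenTorusLRO (fun L x y => groundStateAxisCorrTorus (d := 2) L n 1 (-Δ) 1 x y) := by
  refine hasStaggeredEvenTorusLRO_iff_hasEvenTorusLRO_of_eq fun k x y hx hy => ?_
  rcases Nat.eq_zero_or_pos k with rfl | hk
  · exfalso
    have := (mem_halfOpenBox.1 hx) 0
    omega
  · haveI : NeZero (2 * k) := ⟨by omega⟩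
    rw [torusPullback_apply, torusPullback_apply, latticeStagger_eq_of_mem_halfOpenBox hx,
      latticeStagger_eq_of_mem_halfOpenBox hy,
      groundStateXXZCorrTorus_one_eq_stagger_mul k n hJ Δ]
    have h1 : ((-1 : ℝ) ^ (∑ i, (Torus.proj (2 * k) x i).val)) ^ 2 = 1 := by
      rw [← pow_mul, mul_comm, pow_mul, neg_one_sq, one_pow]
    have h2 : ((-1 : ℝ) ^ (∑ i, (Torus.proj (2 * k) y i).val)) ^ 2 = 1 := by
      rw [← pow_mul, mul_comm, pow_mul, neg_one_sq, one_pow]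
    linear_combination (groundStateAxisCorrTorus (2 * k) n 1 (-Δ) 1 (Torus.proj (2 * k) x)
      (Torus.proj (2 * k) y)) * (h1 * ((-1 : ℝ) ^ (∑ i, (Torus.proj (2 * k) y i).val)) ^ 2 + h2)

/-- **Planar (staggered `y–y`) order of the spin-½ XXZ antiferromagnet on `ℤ²` for `0 ≤ Δ ≤ 0.15`.**
For every `J > 0` and `0 ≤ Δ ≤ 0.15`, the ground states of `xxzHamiltonian 1 (torusGraph 2 L) J Δ` on
the even tori `(ℤ/2kℤ)²` have staggered long-range order of the `y`-component:
`liminf_k (2k)⁻⁴ Σ_{x,y}(-1)^x(-1)^y⟨Sʸ_xSʸ_y⟩_GS > 0` — the dictionary applied to the tree's certified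
planar window `xxz_ground_lro_spinHalf_window` (⊇ Kubo–Kishi's printed `[0, 0.13)`; W–MH print
`[0, 0.22]`). [cite: WischmannMullerhartmann1991, Abstract (p. 647)] [cite: KuboKishi1988] -/
theorem xxzAF_ground_planar_spinHalf (J : ℝ) (hJ : 0 < J) (Δ : ℝ) (hΔ : 0 ≤ Δ) (hΔ' : Δ ≤ 0.15) :
    HasStaggeredEvenTorusLRO (fun L x y => groundStateXXZCorrTorus 1 (d := 2) L 1 J Δ x y) := by
  rw [hasStaggeredEvenTorusLRO_xxz_one_iff 1 hJ Δ]
  exact xxz_ground_lro_spinHalf_window Δ hΔ hΔ'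

/-- The same planar window for the `x`-component (by the `U(1)` symmetry
`groundStateXXZCorrTorus_zero_eq_one`). [cite: WischmannMullerhartmann1991, Abstract (p. 647)]
[cite: KuboKishi1988] -/
theorem xxzAF_ground_planar_spinHalf_x (J : ℝ) (hJ : 0 < J) (Δ : ℝ) (hΔ : 0 ≤ Δ) (hΔ' : Δ ≤ 0.15) :
    HasStaggeredEvenTorusLRO (fun L x y => groundStateXXZCorrTorus 0 (d := 2) L 1 J Δ x y) := by
  have h : (fun (L : ℕ) (x y : TorusSite 2 L) => groundStateXXZCorrTorus 0 (d := 2) L 1 J Δ x y) =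
      fun L x y => groundStateXXZCorrTorus 1 (d := 2) L 1 J Δ x y := by
    funext L x y
    exact groundStateXXZCorrTorus_zero_eq_one L 1 J Δ x y
  rw [h]
  exact xxzAF_ground_planar_spinHalf J hJ Δ hΔ hΔ'

end Planar

/-! ### The hard-core boson (ferromagnetic-planar) sign: plain planar order for `-0.15 ≤ Δ ≤ 0` -/

section HardCoreBoson

/-- **The ferromagnetic-planar XXZ model is B–U's planar frame with no sublattice rotation**:
`groundStateXXZCorrTorus 1 L n (-1) Δ x y = groundStateAxisCorrTorus L n 1 Δ 1 x y` for every side `L`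
(`xxzHamiltonian n (torusGraph d L) (-1) Δ = -Σ(SˣSˣ + SʸSʸ + ΔSᶻSᶻ) = H₃(1,1,Δ) = ½H(1,1,Δ)`, then the
global quarter turn about `x`). [cite: BjornbergUeltschi2022, Prop. 2.4] [cite: KLS1988PRL, eq. (1)] -/
theorem groundStateXXZCorrTorus_one_neg_one (L n : ℕ) (Δ : ℝ) (x y : TorusSite d L) :
    groundStateXXZCorrTorus 1 L n (-1) Δ x y = groundStateAxisCorrTorus L n 1 Δ 1 x y := by
  rcases Nat.eq_zero_or_pos L with rfl | hL
  · simp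
  · haveI : NeZero L := ⟨hL.ne'⟩
    rw [groundStateXXZCorrTorus_of_neZero, groundStateAxisCorrTorus_of_neZero,
      groundStateFunctional_xxzHamiltonian_torus, neg_neg, neg_mul, one_mul, neg_neg,
      groundStateFunctional_anisotropicTorus_quarterTurnX]

/-- **Planar long-range order of hard-core bosons with weak nearest-neighbour repulsion** (spin-½,
`d = 2`): for `-0.15 ≤ Δ ≤ 0` the ground states of `xxzHamiltonian 1 (torusGraph 2 L) (-1) Δ =
-Σ_{⟨x,y⟩}(SˣSˣ + SʸSʸ + ΔSᶻSᶻ)` (planar ferromagnet + Ising ANTIferromagnet `|Δ|`, the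
`HubbardSuperconductivity` routes' `H_M(Δ)`) on the even tori have PLAIN long-range order of the
`y`-component, `liminf_k (2k)⁻⁴ Σ_{x,y} ⟨Sʸ_xSʸ_y⟩_GS > 0` — the certified window
`xxz_ground_lro_spinHalf_window'` read through `groundStateXXZCorrTorus_one_neg_one`; the endpoint
`Δ = 0` is Kennedy–Lieb–Shastry's XY model. [cite: KLS1988PRL, eq. (1) and Theorem]
[cite: BjornbergUeltschi2022, p. 11] [cite: KuboKishi1988] -/
theorem hardCoreBoson_ground_planar_spinHalf (Δ : ℝ) (hΔ : -0.15 ≤ Δ) (hΔ' : Δ ≤ 0) :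
    HasEvenTorusLRO (fun L x y => groundStateXXZCorrTorus 1 (d := 2) L 1 (-1) Δ x y) := by
  have h : (fun (L : ℕ) (x y : TorusSite 2 L) => groundStateXXZCorrTorus 1 (d := 2) L 1 (-1) Δ x y) =
      fun L x y => groundStateAxisCorrTorus (d := 2) L 1 1 Δ 1 x y := by
    funext L x y
    exact groundStateXXZCorrTorus_one_neg_one L 1 Δ x y
  rw [h]
  exact xxz_ground_lro_spinHalf_window' Δ (by linarith) (by norm_num at hΔ ⊢; linarith)

/-- The same for the `x`-component (by `groundStateXXZCorrTorus_zero_eq_one`).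
[cite: KLS1988PRL, eq. (1) and Theorem] [cite: KuboKishi1988] -/
theorem hardCoreBoson_ground_planar_spinHalf_x (Δ : ℝ) (hΔ : -0.15 ≤ Δ) (hΔ' : Δ ≤ 0) :
    HasEvenTorusLRO (fun L x y => groundStateXXZCorrTorus 0 (d := 2) L 1 (-1) Δ x y) := by
  have h : (fun (L : ℕ) (x y : TorusSite 2 L) => groundStateXXZCorrTorus 0 (d := 2) L 1 (-1) Δ x y) =
      fun L x y => groundStateXXZCorrTorus 1 (d := 2) L 1 (-1) Δ x y := by
    funext L x y
    exact groundStateXXZCorrTorus_zero_eq_one L 1 (-1) Δ x y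
  rw [h]
  exact hardCoreBoson_ground_planar_spinHalf Δ hΔ hΔ'

end HardCoreBoson

end Literature.MathematicalPhysics.QuantumLattice

end
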